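import Summits.Ventures.PercRepro.C026PendantMarkStep
import Summits.Ventures.PercRepro.C026SmallReduction
import Summits.Ventures.PercRepro.Transport

/-!
# The mark calculus: series–parallel–pendant steps, the pendant-mark step, and the five-vertex endpoint (p6, gen 12)

The reduction calculus of `C026SeriesParallel.lean` (series at a non-mark, parallel, pendant
non-mark; dead edges deleted at the end) is extended by the **pendant-mark step** of
`C026PendantMarkStep.lean` — a mark `c` pendant on a single edge `c–w` moves to `w` — so the marks
change along a reduction: an instance is now `((G, p), (a, b, c))` (`MInst`), a step `MStep`, a
reduction `MReduces` (the reflexive–transitive closure), and C-026 transports backwards along it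
(`MInst.C026_of_reduces`).

The **five-vertex endpoint with an explicit dead set** (`C026At_of_mapVertices_five_dead`): an
instance whose support outside a dead set `D` (weight `0`) — the vertices carrying an edge not in `D`,
and the marks — maps injectively into `Fin 5` satisfies C-026 at every edge weight, by p5's
`c026UpTo5` after the dead edges are deleted (`prob_partitionEvent_eq_minor_of_dead`) and the
isolated vertices folded away along the transport `law3_map` of `C026SmallReduction.lean`
(`C026At_of_fold_five`).  It is the decidable twin of `C026At_of_card_liveSupp_le_five` (same file):
there the live support `LiveSupp` is `p e ≠ 0`, here the dead set is named, so that a concrete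
instance can `decide` it.  `MInst.C026_of_reduces_five` chains the two: a reduction to an instance
of support ≤ 5 outside its dead set proves C-026 for the start.

`proofs/P6-unicyclic.md` (Theorem U): every marked multigraph with at most one cycle so reduces.
-/

namespace PercRepro

open Finset

namespace MultiGraph

variable {V E : Type} [Fintype E] [DecidableEq E]

/-- A marked instance: a weighted multigraph and its three marks. -/
abbrev MInst (V E : Type) := (MultiGraph V E × (E → ℝ)) × (V × V × V)

/-- **A step of the mark calculus**: a series–parallel–pendant step at fixed marks, or a pendant mark
moving to its neighbour (its edge killed). -/
inductive MStep : MInst V E → MInst V E → Prop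
  | sp {x y : MultiGraph V E × (E → ℝ)} {a b c : V} (h : SPStep3 a b c x y) :
      MStep (x, (a, b, c)) (y, (a, b, c))
  | pendantMark {G : MultiGraph V E} {p : E → ℝ} {a b c w : V} {f : E} (h : G.PendantOn c w f)
      (hcw : c ≠ w) (hca : c ≠ a) (hcb : c ≠ b) :
      MStep ((G, p), (a, b, c)) ((G, Function.update p f 0), (a, b, w))

/-- **Reduction in the mark calculus**: the reflexive–transitive closure of the steps. -/
def MReduces : MInst V E → MInst V E → Prop := Relation.ReflTransGen MStep

/-- C-026 for a marked instance. -/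
def MInst.C026 (x : MInst V E) : Prop := x.1.1.C026At x.1.2 x.2.1 x.2.2.1 x.2.2.2

omit [Fintype E] in
/-- A step preserves probability vectors. -/
theorem MStep.isProb {x y : MInst V E} (h : MStep x y) (hp : IsProb x.1.2) : IsProb y.1.2 := by
  cases h with
  | sp h => exact h.isProb hp
  | @pendantMark G p a b c w f _ _ _ _ =>
    intro e
    show 0 ≤ Function.update p f 0 e ∧ Function.update p f 0 e ≤ 1
    by_cases he : e = f
    · subst he
      simp
    · rw [Function.update_of_ne he]
      exact hp e

omit [Fintype E] in
/-- A reduction preserves probability vectors. -/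
theorem MReduces.isProb {x y : MInst V E} (h : MReduces x y) (hp : IsProb x.1.2) :
    IsProb y.1.2 := by
  induction h with
  | refl => exact hp
  | tail _ hstep ih => exact hstep.isProb ih

/-- **C-026 transports backwards along a step** (the pendant-mark step needs a probability vector). -/
theorem MInst.C026_of_step {x y : MInst V E} (h : MStep x y) (hp : IsProb x.1.2) (hy : y.C026) :
    x.C026 := by
  cases h with
  | sp h => exact C026At_of_step h hy
  | pendantMark h hcw hca hcb => exact C026At_of_pendantMark hp h hcw hca hcb hy

/-- **C-026 transports backwards along a reduction.** -/
theorem MInst.C026_of_reduces {x y : MInst V E} (h : MReduces x y) :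
    IsProb x.1.2 → y.C026 → x.C026 := by
  induction h using Relation.ReflTransGen.head_induction_on with
  | refl => exact fun _ hy => hy
  | head hstep _ ih => exact fun hp hy => MInst.C026_of_step hstep hp (ih (hstep.isProb hp) hy)

/-! ### The five-vertex endpoint with dead edges -/

/-- **Folding the isolated vertices away**: a vertex map into `Fin 5` injective on the support of the
marks gives C-026 at every edge weight (p5's `c026UpTo5` on `mapVertices`, through the transport
`law3_map` of `C026SmallReduction.lean` with the identity on edges). -/
theorem C026At_of_fold_five (G : MultiGraph V E) (a b c : V) (φ : V → Fin 5)
    (hinj : ∀ x y, G.Supp a b c x → G.Supp a b c y → φ x = φ y → x = y) {p : E → ℝ}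
    (hp : IsProb p) : G.C026At p a b c := by
  have hfst : ∀ e, (G.mapVertices φ).fst ((Equiv.refl E) e) = φ (G.fst e) := fun _ => rfl
  have hsnd : ∀ e, (G.mapVertices φ).snd ((Equiv.refl E) e) = φ (G.snd e) := fun _ => rfl
  unfold C026At
  rw [show G.law3 p a b c = (G.mapVertices φ).law3 p (φ a) (φ b) (φ c) from
    law3_map hfst hsnd hinj p]
  exact c026UpTo5 (by simp) (G.mapVertices φ) p hp (φ a) (φ b) (φ c)

/-- **The support outside a dead set** `D`: the vertices carrying an edge not in `D`, and the marks
(the decidable twin of `LiveSupp`, where «live» is `p e ≠ 0`). -/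
def SuppOutside (G : MultiGraph V E) (D : Finset E) (a b c : V) (x : V) : Prop :=
  (∃ e, e ∉ D ∧ G.EdgeAt e x) ∨ x = a ∨ x = b ∨ x = c

/-- The support outside a dead set is decidable on finite types. -/
instance decidableSuppOutside [DecidableEq V] (G : MultiGraph V E) (D : Finset E) (a b c x : V) :
    Decidable (G.SuppOutside D a b c x) :=
  decidable_of_iff ((∃ e, e ∉ D ∧ (G.fst e = x ∨ G.snd e = x)) ∨ x = a ∨ x = b ∨ x = c)
    ⟨fun h => h, fun h => h⟩

omit [Fintype E] [DecidableEq E] in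
/-- With nothing sure, the sure classes are the vertices: `φ` lifts to the quotient. -/
theorem conn_bot_imp_eq {G : MultiGraph V E} {x y : V} (h : G.Conn ⊥ x y) : x = y :=
  (G.sureClass_bot_eq_iff x y).mp ((G.sureClass_eq_iff ⊥ x y).mpr h)

/-- **The five-vertex endpoint with dead edges**: if the edges of `D` are dead and a vertex map into
`Fin 5` is injective on the support outside `D`, C-026 holds at `p`. -/
theorem C026At_of_mapVertices_five_dead (G : MultiGraph V E) {p : E → ℝ} (hp : IsProb p)
    (a b c : V) (D : Finset E) (hD : ∀ e ∈ D, p e = 0) (φ : V → Fin 5)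
    (hinj : ∀ x y, G.SuppOutside D a b c x → G.SuppOutside D a b c y → φ x = φ y → x = y) :
    G.C026At p a b c := by
  classical
  let u : Config E := fun e => decide (e ∉ D)
  have hd : DeadOutside p u := fun e he => hD e (by simpa [u] using he)
  have hm : (fun i => G.sureClass ⊥ ((![a, b, c] : Fin 3 → V) i)) =
      ![G.sureClass ⊥ a, G.sureClass ⊥ b, G.sureClass ⊥ c] := by
    funext i
    fin_cases i <;> rfl
  have hrow : G.law3 p a b c = (G.minor u ⊥).law3 (faceWeight p u ⊥) (G.sureClass ⊥ a)
      (G.sureClass ⊥ b) (G.sureClass ⊥ c) := by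
    funext s
    unfold law3
    rw [G.prob_partitionEvent_eq_minor_of_dead p hd ![a, b, c] (rgs3 s), hm]
  unfold C026At
  rw [hrow]
  have hφ : ∀ x y, G.connSetoid ⊥ x y → φ x = φ y := fun x y h => by
    rw [conn_bot_imp_eq (G := G) h]
  refine (G.minor u ⊥).C026At_of_fold_five _ _ _ (Quotient.lift φ hφ) ?_
    (isProb_faceWeight hp u ⊥)
  have key : ∀ z, (G.minor u ⊥).Supp (G.sureClass ⊥ a) (G.sureClass ⊥ b) (G.sureClass ⊥ c)
      (G.sureClass ⊥ z) → G.SuppOutside D a b c z := by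
    intro z hz
    rcases hz with ⟨e, he⟩ | hz | hz | hz
    · have heD : e.1 ∉ D := by
        have := e.2.2
        simpa [u] using this
      rcases he with he | he
      · exact Or.inl ⟨e.1, heD, Or.inl ((G.sureClass_bot_eq_iff _ _).mp he)⟩
      · exact Or.inl ⟨e.1, heD, Or.inr ((G.sureClass_bot_eq_iff _ _).mp he)⟩
    · exact Or.inr (Or.inl ((G.sureClass_bot_eq_iff _ _).mp hz))
    · exact Or.inr (Or.inr (Or.inl ((G.sureClass_bot_eq_iff _ _).mp hz)))
    · exact Or.inr (Or.inr (Or.inr ((G.sureClass_bot_eq_iff _ _).mp hz)))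
  intro x y hx hy hxy
  induction x using Quotient.inductionOn with
  | h x =>
    induction y using Quotient.inductionOn with
    | h y =>
      have hxy' : φ x = φ y := hxy
      exact congrArg _ (hinj x y (key x hx) (key y hy) hxy')

/-- **The five-vertex endpoint of the mark calculus**: a reduction to an instance whose support
outside a dead set has at most five vertices proves C-026 for the starting instance. -/
theorem MInst.C026_of_reduces_five {x : MInst V E} (hp : IsProb x.1.2) {G' : MultiGraph V E}
    {p' : E → ℝ} {a' b' c' : V} (h : MReduces x ((G', p'), (a', b', c'))) (D : Finset E)
    (hD : ∀ e ∈ D, p' e = 0) (φ : V → Fin 5)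
    (hinj : ∀ y z, G'.SuppOutside D a' b' c' y → G'.SuppOutside D a' b' c' z → φ y = φ z → y = z) :
    x.C026 :=
  MInst.C026_of_reduces h hp
    (G'.C026At_of_mapVertices_five_dead (h.isProb hp) a' b' c' D hD φ hinj)

end MultiGraph

end PercRepro
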